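import Summits.BirchSwinnertonDyer.BirchSwinnertonDyer.Theorems.UniversalToricDescentStrictPlaceGrowthLayerCount
import Summits.BirchSwinnertonDyer.BirchSwinnertonDyer.Theorems.UniversalToricDescentDualPairCokernelCount
import Summits.BirchSwinnertonDyer.BirchSwinnertonDyer.Theorems.UniversalToricDescentStrictPlaceGrowthTorsionFree
import Summits.BirchSwinnertonDyer.BirchSwinnertonDyer.Theorems.UniversalToricDescentGrowthInjectivity
import HarnessLib

/-!
# GV Prop. 2.1 at the strict place FROM A LOCAL TWO-SIDED COUNT — the growth-road reduction of stub TS1′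
# (crux ♭T≤ stmt-BirchSwinnertonDyer-23042 `DefectTransportModThreePT`, line `sigmacongruence`, stub `stub_twinStrictSurj`)

Route `UniversalToricDescent`, lead prover `bsd-wall-utd-p1` g16–g17. THEOREMS ONLY (no definition, no named fact, no `sorry`);
`--supports stmt-BirchSwinnertonDyer-23042`. BSD is not proved by any of this.

**Theorem** (`exists_mem_selmerAc_forall_resKerD_eq_of_localCount`, §3). Let `K` be a totally complex number field, `κ` a
`ℤ_p`-extension with topological generator `γ`, `E/K` elliptic with `E(K_∞)[p^∞] = 0`, Poitou–Tate over every layer `K_n`,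
`𝔭` a place with exact index `κ(D_𝔭) = p^c ℤ_p` and `d₁ ∈ D_𝔭`, `κ d₁ = p^c`, `Σ` finite, `v₀ ∤ p` a fake strict place, and
`Sel_𝔭^Σ(K_∞, E[p^∞])[p]` finite. IF the local group `𝓗 = H¹(kerD κ 𝔭, E[p^∞])` (`= H¹(K_{∞,w}, E[p^∞])`) satisfies the
TWO-SIDED COUNT `p^{[K:ℚ] p^n k} ≤ p^b · #{y ∈ 𝓗 | p^k y = 0, conj_{d₁^{p^n}} y = y} ≤ p^{[K:ℚ] p^n k + b}` for all `n, k`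
(finite sets), THEN every right-`ker κ`-invariant, left-`D_𝔭`-equivariant `F : Γ_K → 𝓗` is the signature `σ ↦ res(conj_σ s)`
of some `s ∈ Sel^{Σ}_{v₀}(K_∞, E[p^∞])` — the conclusion of `stub_twinStrictSurj`.

Proof (the GROWTH ROAD, memo GROWTH-ROAD-utdp1g15 §1, over `Λ_c = ℤ_p⟦γ^{p^c} − 1⟧`). §1 `surjective_of_dualPair_growth` is
the road in ABSTRACT form: for locally nilpotent `ψ_Y`, `ψ_P` intertwined by `Θ : S_Y → S_P`, with `Hom(S_Y, ℚ/ℤ)`,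
`Hom(S_P, ℚ/ℤ)` finitely generated (`IsLocNil.module`) and the latter torsion-free, the three diagonal counts (local count,
kernel count, weak Leopoldt) make the transpose `Θ^∨` injective (`injective_of_weakLeopoldt_growth`, p645087; cokernel count
p664051) and hence `Θ` onto (`surjective_of_injective_transpose`, p660921). §2 supplies the concrete inputs for
`S_Y = Sel^{Σ}_{v₀}`, `ψ_Y = conj_{γ^{p^c}} − 1` and the TUPLE target `S_P = 𝓗^{p^c}`, `ψ_P` = componentwise `conj_{d₁} − 1`:
local nilpotence, finite generation (p662345), the weak-Leopoldt count in the `Λ_c`-variables (p664255 at layer `c + m`),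
the injection `{s ∈ ker Θ | p^m s = 0} ↪ Sel_𝔭^Σ[p^m]` (tuple form of the kernel) — stated through a GENERIC subgroup
transport so that no concrete Selmer group is ever unfolded — and the intertwining `Θ ∘ ψ_Y = ψ_P ∘ Θ`
(`resKerD_conjH1_pow_index`). §3 assembles: signature surjectivity ⟸ tuple surjectivity (p661733), `X_P` finitely generated and
torsion-free from the local count (p664548), `#ker`-count `≤ p^{em+f}` (p662345).

What is left for TS1′ on the route (imaginary quadratic `K`, `p = 3` split, `𝔭′` of degree one): the LOCAL two-sided count at
`𝔭′` (local Euler characteristic over the layers of `K_{∞,w}/ℚ₃`, `E′(K_{∞,w})[3^∞]` finite — brick (1c±)).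

References: [GreenbergVatsal2000] §2 Prop. (2.1) (pp. 23–24); [GreenbergLNM1716] §1 p. 60, §3 Lemma 3.1, §4 Prop. 4.13–4.15;
[Washington1997] §13.2; [Castella2018] Def. 2.2.
-/

set_option autoImplicit false
-- the Theorems namespace of this sub repeats the summit name by design (D-0017 nested layout)
set_option linter.dupNamespace false

noncomputable section

open scoped Classical

/-! ### §1 The growth road, abstract form -/

namespace Summit.BirchSwinnertonDyer.BirchSwinnertonDyer.Theorems.UniversalToricDescentTorsionFreeByCount

open Literature.NumberTheory.EllipticCurves Literature.NumberTheory.EllipticCurves.IwasawaDual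
  Summit.BirchSwinnertonDyer.BirchSwinnertonDyer.Theorems.UniversalToricDescentDualPairIdealCount
  Summit.BirchSwinnertonDyer.BirchSwinnertonDyer.Theorems.UniversalToricDescentGrowthInjective

variable (p : ℕ) [hp : Fact p.Prime]

/-- **The growth road, abstract form: `Θ : S_Y → S_P` is onto** when, for the `Λ`-structures `IsLocNil.module` of locally
nilpotent `ψ_Y`, `ψ_P` intertwined by `Θ`, the duals `X_Y = Hom(S_Y, ℚ/ℤ)`, `X_P = Hom(S_P, ℚ/ℤ)` are finitely generated,
`X_P` is `Λ`-torsion-free, and the three diagonal counts hold: `#S_P[p^m]^{(1+ψ_P)^{p^m}} ≤ p^{d m p^m + b}` (local Euler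
characteristic), `#{s ∈ ker Θ | p^m s = 0} ≤ p^{e m + f}` (through an injection into a finite type), and the weak-Leopoldt
inequality `p^{d m p^m} ≤ #S_Y[p^m]^{(1+ψ_Y)^{p^m}}`. Proof: the transpose `Θ^∨ : X_P → X_Y` (`IsDualPair.exists_linearMap_comp`)
is injective by `injective_of_weakLeopoldt_growth` (p645087) — its three counts are the given ones read through
`natCard_quotient_span_pow_omega_smul` (p646050) and the cokernel count `natCard_coker_quotient_le_of_injective` (p664051) — and an
injective transpose forces `Θ` onto (`surjective_of_injective_transpose`, p660921).
[cite: GreenbergVatsal2000, §2 Prop. (2.1) (pp. 23–24)] [cite: GreenbergLNM1716, §1 p. 60] [cite: Washington1997, §13.2] -/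
theorem surjective_of_dualPair_growth
    {SY : Type} [AddCommGroup SY] {ψY : AddMonoid.End SY} (hLY : IsLocNil p ψY)
    {SP : Type} [AddCommGroup SP] {ψP : AddMonoid.End SP} (hLP : IsLocNil p ψP)
    (Θ : SY →+ SP) (hΘψ : ∀ s, Θ (ψY s) = ψP (Θ s)) (d b e f : ℕ) :
    letI := hLY.module (A := AddCircle (1 : ℚ)); letI := hLP.module (A := AddCircle (1 : ℚ))
    ∀ [Module.Finite (PowerSeries ℤ_[p]) (SY →+ AddCircle (1 : ℚ))]
      [Module.Finite (PowerSeries ℤ_[p]) (SP →+ AddCircle (1 : ℚ))]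
      [NoZeroSMulDivisors (PowerSeries ℤ_[p]) (SP →+ AddCircle (1 : ℚ))]
      (_hQ : ∀ m : ℕ, Nat.card ((DistribSMul.toAddMonoidHom SP (p ^ m)).ker ⊓ ((1 + ψP) ^ (p ^ m) - 1).ker :
        AddSubgroup SP) ≤ p ^ (d * m * p ^ m + b))
      (_hX : ∀ m : ℕ, ∃ (T : Type) (_ : Finite T) (ι : {s : SY // s ∈ Θ.ker ∧ p ^ m • s = 0} → T),
        Function.Injective ι ∧ Nat.card T ≤ p ^ (e * m + f))
      (_hY : ∀ m : ℕ, p ^ (d * m * p ^ m) ≤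
        Nat.card ((DistribSMul.toAddMonoidHom SY (p ^ m)).ker ⊓ ((1 + ψY) ^ (p ^ m) - 1).ker : AddSubgroup SY)),
      Function.Surjective Θ := by
  letI instY := hLY.module (A := AddCircle (1 : ℚ))
  letI instP := hLP.module (A := AddCircle (1 : ℚ))
  intro _ _ _ hQ hX hY
  have hdY := isDualPair_id_of_isLocNil p hLY
  have hdP := isDualPair_id_of_isLocNil p hLP
  obtain ⟨Fd, hFd⟩ := hdP.exists_linearMap_comp hdY Θ hΘψ
  have hinj : Function.Injective Fd := by
    refine injective_of_weakLeopoldt_growth p Fd d b e f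
      (fun m ↦ finite_quotient_span_pow_omega_smul_top p _ m m)
      (fun m ↦ finite_quotient_span_pow_omega_smul_top p _ m m) (fun m ↦ ?_) (fun m ↦ ?_) (fun m ↦ ?_)
    · have h := natCard_quotient_span_pow_omega_smul hdP m m
      rw [Nat.cast_pow] at h
      rw [h]
      exact hQ m
    · obtain ⟨T, _, ι, hι, hT⟩ := hX m
      exact (natCard_coker_quotient_le_of_injective p hLY hLP Θ hΘψ Fd hFd m ι hι).trans hT
    · have h := natCard_quotient_span_pow_omega_smul hdY m m
      rw [Nat.cast_pow] at h
      rw [h]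
      exact hY m
  exact surjective_of_injective_transpose p hdY hdP Θ Fd hFd hinj

end Summit.BirchSwinnertonDyer.BirchSwinnertonDyer.Theorems.UniversalToricDescentTorsionFreeByCount

namespace Summit.BirchSwinnertonDyer.BirchSwinnertonDyer.Theorems.UniversalToricDescentStrictPlaceGrowth

open Function Field NumberField IsDedekindDomain WeierstrassCurve
open Literature.NumberTheory.GaloisRepresentations Literature.NumberTheory.EllipticCurves
  Literature.NumberTheory.EllipticCurves.GreenbergSelmer Literature.NumberTheory.EllipticCurves.IwasawaDual
  Literature.NumberTheory.GaloisCohomology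
  Summit.BirchSwinnertonDyer.Rank1Residual Summit.BirchSwinnertonDyer.Rank1Residual.X11b
  Summit.BirchSwinnertonDyer.Rank1Residual.X11b.Coinv Summit.BirchSwinnertonDyer.Rank1Residual.X11b.AcSelmer
  Summit.BirchSwinnertonDyer.BirchSwinnertonDyer.Theorems.UniversalToricDescentTorsionFreeByCount
  Summit.BirchSwinnertonDyer.BirchSwinnertonDyer.Theorems.UniversalToricDescentDualPairIdealCount
  Summit.BirchSwinnertonDyer.BirchSwinnertonDyer.Theorems.UniversalToricDescentGrowthInjective
  Summit.BirchSwinnertonDyer.BirchSwinnertonDyer.Theorems.UniversalToricDescentStrictPlaceTuple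

variable {K : Type} [Field K] [NumberField K] (W : WeierstrassCurve K) [W.IsElliptic] (p : ℕ)
  [Fact p.Prime] (κ : ZpExtension K p)

/-! ### §2 Concrete inputs on `Sel^{Σ}_{v₀}(K_∞, E[p^∞])` -/

omit [W.IsElliptic] in
/-- `conj_{γ^{p^c}}` on `Sel^{Σ}_{v₀}` is the `p^c`-th power of `conj_γ`. [folklore] -/
theorem conjSelmerAc_pow_eq (γ : absoluteGaloisGroup K) (v₀ : HeightOneSpectrum (𝓞 K))
    (S : Set (HeightOneSpectrum (𝓞 K))) (q : ℕ) :
    conjSelmerAc W p κ v₀ S (γ ^ q) = (conjSelmerAc W p κ v₀ S γ) ^ q := by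
  refine DFunLike.ext _ _ fun s ↦ Subtype.ext ?_
  rw [coe_conjSelmerAc_apply, coe_conjSelmerAc_pow_apply]

omit [W.IsElliptic] in
/-- **`(p, conj_{γ^{p^c}} − 1)` is locally nilpotent on `Sel^{Σ}_{v₀}(K_∞, E[p^∞])`** (`(1+ψ)^{p^c} − 1` for `ψ = conj_γ − 1`).
[cite: GreenbergLNM1716, §1 (after Conj. 1.3)] -/
theorem isLocNil_conjSelmerAc_pow_sub_one {γ : absoluteGaloisGroup K} (hγ : κ.IsTopGenerator γ)
    (v₀ : HeightOneSpectrum (𝓞 K)) (S : Set (HeightOneSpectrum (𝓞 K))) (q : ℕ) :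
    IsLocNil p (conjSelmerAc W p κ v₀ S (γ ^ q) - 1) := by
  have h1 := isLocNil_one_add_pow_sub_one p (isLocNil_conjSelmerAc_sub_one W p κ v₀ S hγ) q
  rwa [add_sub_cancel, ← conjSelmerAc_pow_eq] at h1

/-- **`X_Y = Hom(Sel^{Σ}_{v₀}, ℚ/ℤ)` is finitely generated** for the `Λ_c`-structure `T ↦ conj_{γ^{p^c}} − 1` (Nakayama for dual
pairs: `{s | p s = 0, conj_{γ^{p^c}} s = s}` is finite, `…StrictPlaceGrowthInputs`). [cite: GreenbergLNM1716, §1 p. 60] -/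
theorem moduleFinite_dual_selmerAc {γ : absoluteGaloisGroup K} (hγ : κ.IsTopGenerator γ)
    (v₀ : HeightOneSpectrum (𝓞 K)) {S : Set (HeightOneSpectrum (𝓞 K))} (hS : S.Finite) (c : ℕ)
    (hLY : IsLocNil p (conjSelmerAc W p κ v₀ S (γ ^ p ^ c) - 1)) :
    letI := hLY.module (A := AddCircle (1 : ℚ))
    Module.Finite (PowerSeries ℤ_[p]) (selmerAc W p κ v₀ S →+ AddCircle (1 : ℚ)) := by
  letI := hLY.module (A := AddCircle (1 : ℚ))
  refine (isDualPair_id_of_isLocNil p hLY).module_finite ?_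
  refine (finite_pTorsion_pow_conjH1_pow_fixed W p κ hγ v₀ hS c 1).subset fun s hs ↦ ?_
  rw [SetLike.mem_coe, IwasawaDual.mem_piece] at hs
  refine ⟨hs.1, ?_⟩
  have h2 := hs.2
  rw [pow_one, IwasawaDual.End_sub_apply, AddMonoid.End.one_apply, sub_eq_zero] at h2
  have h3 := congrArg (fun z : selmerAc W p κ v₀ S ↦ (z : W.subgroupH1 p κ.kerSubgroup)) h2
  simpa only [coe_conjSelmerAc_apply] using h3

/-- **The weak-Leopoldt count in the `Λ_c`-variables**: `p^{[K:ℚ] p^c m p^m} ≤ #{s ∈ Sel^{Σ}_{v₀} | p^m s = 0, (conj_{γ^{p^c}})^{p^m} s = s}`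
(p664255 at the layer `c + m`, constants `1`). [cite: GreenbergLNM1716, Thm 1.7, §3 Lemma 3.1] [cite: GreenbergVatsal2000, §2 Prop. (2.1)] -/
theorem prime_pow_le_natCard_pTorsion_inf_conjSelmerAc_pow_fixed [IsTotallyComplex K]
    (hPT : ∀ n : ℕ, poitouTate_selmerStructure_duality (κ.layer n))
    (hB : FixedPoints.addSubgroup κ.kerSubgroup (W.geomPrimaryTorsion p) = ⊥)
    {γ : absoluteGaloisGroup K} (hγ : κ.IsTopGenerator γ) (v₀ : HeightOneSpectrum (𝓞 K))
    (hv₀ : ((p : ℕ) : 𝓞 K) ∉ v₀.asIdeal) {S : Set (HeightOneSpectrum (𝓞 K))} (hS : S.Finite) (c m : ℕ) :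
    p ^ (Module.finrank ℚ K * p ^ c * m * p ^ m) ≤
      Nat.card ((DistribSMul.toAddMonoidHom (selmerAc W p κ v₀ S) (p ^ m)).ker ⊓
        ((1 + (conjSelmerAc W p κ v₀ S (γ ^ p ^ c) - 1)) ^ (p ^ m) - 1).ker : AddSubgroup (selmerAc W p κ v₀ S)) := by
  have hcount := prime_pow_le_natCard_pTorsion_pow_conjH1_pow_fixed W p κ (n := c + m) (hPT (c + m)) hB hγ v₀ hv₀ hS m
  have e1 : Module.finrank ℚ K * p ^ c * m * p ^ m = m * (p ^ (c + m) * Module.finrank ℚ K) := by rw [pow_add]; ring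
  rw [e1]
  refine hcount.trans (le_of_eq (Nat.card_congr (Equiv.subtypeEquivRight fun s ↦ ?_)))
  rw [AddSubgroup.mem_inf, AddMonoidHom.mem_ker, AddMonoidHom.mem_ker, DistribSMul.toAddMonoidHom_apply,
    add_sub_cancel, conjSelmerAc_pow_eq, ← pow_mul, ← pow_add]
  refine and_congr Iff.rfl ?_
  change _ ↔ ((conjSelmerAc W p κ v₀ S γ) ^ p ^ (c + m)) s - s = 0
  rw [sub_eq_zero]
  refine ⟨fun h ↦ Subtype.ext (by rw [coe_conjSelmerAc_pow_apply]; exact h), fun h ↦ ?_⟩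
  have h' := congrArg (fun z : selmerAc W p κ v₀ S ↦ (z : W.subgroupH1 p κ.kerSubgroup)) h
  rwa [coe_conjSelmerAc_pow_apply] at h'

/-- Generic transport: for subgroups `A, B ≤ X` and a predicate `P` on `A` with `P a → a ∈ B`, the `n`-torsion of `{a | P a}` injects
into the `n`-torsion of `B` (stated for abstract `A, B` so that no unfolding of concrete subgroups is ever needed). [folklore] -/
theorem exists_injective_subtype_of_coe_mem {X : Type*} [AddCommGroup X] {A B : AddSubgroup X} (P : A → Prop) (n : ℕ)
    (hP : ∀ a : A, P a → (a : X) ∈ B) :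
    ∃ ι : {a : A // P a ∧ n • a = 0} → {b : B // n • b = 0}, Function.Injective ι := by
  refine ⟨fun t ↦ ⟨⟨(t.1 : X), hP t.1 t.2.1⟩, ?_⟩, fun t₁ t₂ h ↦ ?_⟩
  · apply Subtype.ext
    have ht := congrArg (fun a : A ↦ (a : X)) t.2.2
    simp only [AddSubgroupClass.coe_nsmul, ZeroMemClass.coe_zero] at ht ⊢
    exact ht
  · have h' := congrArg (fun b : {b : B // n • b = 0} ↦ ((b : B) : X)) h
    exact Subtype.ext (Subtype.ext h')

omit [W.IsElliptic] in
/-- **`{s ∈ ker Θ | p^m s = 0} ↪ Sel_𝔭^Σ[p^m]`** for the tuple map `Θ s = (res_G(conj_{γ^i} s))_{i<p^c}` (`ker Θ ⊆ Sel_𝔭^Σ` by the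
tuple form of the kernel, `…StrictPlaceTupleSignature`). [cite: GreenbergVatsal2000, §2 Cor. (2.3) (p. 25)] -/
theorem exists_injective_kerTuple_pTorsion {γ : absoluteGaloisGroup K} (hγ : κ.IsTopGenerator γ)
    {𝔭 : HeightOneSpectrum (𝓞 K)} {c : ℕ}
    (hc : ∀ z : ℤ_[p], ∃ d : decomp (K := K) 𝔭, (κ (d : absoluteGaloisGroup K)).toAdd = (p : ℤ_[p]) ^ c * z)
    {S : Set (HeightOneSpectrum (𝓞 K))} {v₀ : HeightOneSpectrum (𝓞 K)}
    (Θ : selmerAc W p κ v₀ S →+ (Fin (p ^ c) → subgroupH1 (kerD κ 𝔭) (W.geomPrimaryTorsion p)))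
    (hΘ : ∀ (s : selmerAc W p κ v₀ S) (i : Fin (p ^ c)),
      Θ s i = resKerD κ (W.geomPrimaryTorsion p) 𝔭 (W.conjH1 p κ.kerSubgroup (γ ^ (i : ℕ)) s)) (m : ℕ) :
    ∃ ι : {s : selmerAc W p κ v₀ S // s ∈ Θ.ker ∧ p ^ m • s = 0} → {s : selmerAc W p κ 𝔭 S // p ^ m • s = 0},
      Function.Injective ι := by
  refine exists_injective_subtype_of_coe_mem (fun s : selmerAc W p κ v₀ S ↦ s ∈ Θ.ker) (p ^ m) fun s hs ↦ ?_
  refine (mem_selmerAc_iff_forall_fin_of_mem_relaxed W p κ hγ hc s.2).mpr fun i ↦ ?_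
  have h0 := congrFun ((AddMonoidHom.mem_ker).mp hs) i
  rwa [hΘ, Pi.zero_apply] at h0

omit [W.IsElliptic] in
/-- **The tuple map intertwines `conj_{γ^{p^c}} − 1` with the componentwise `conj_{d₁} − 1`** (`…StrictPlaceGrowthLocal` §2).
[cite: GreenbergLNM1716, §3 Lemma 3.3 (p. 87)] -/
theorem tuple_conjSelmerAc_pow_sub_one {γ : absoluteGaloisGroup K} (hγ : κ.IsTopGenerator γ)
    {𝔭 : HeightOneSpectrum (𝓞 K)} {c : ℕ} (d₁ : decomp (K := K) 𝔭)
    (hd₁ : (κ (d₁ : absoluteGaloisGroup K)).toAdd = (p : ℤ_[p]) ^ c)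
    {S : Set (HeightOneSpectrum (𝓞 K))} {v₀ : HeightOneSpectrum (𝓞 K)}
    (Θ : selmerAc W p κ v₀ S →+ (Fin (p ^ c) → subgroupH1 (kerD κ 𝔭) (W.geomPrimaryTorsion p)))
    (hΘ : ∀ (s : selmerAc W p κ v₀ S) (i : Fin (p ^ c)),
      Θ s i = resKerD κ (W.geomPrimaryTorsion p) 𝔭 (W.conjH1 p κ.kerSubgroup (γ ^ (i : ℕ)) s))
    {φ : AddMonoid.End (subgroupH1 (kerD κ 𝔭) (W.geomPrimaryTorsion p))}
    (hφ : ∀ y, φ y = conjH1 (kerD κ 𝔭) (W.geomPrimaryTorsion p) d₁ y)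
    {Ψ : AddMonoid.End (Fin (p ^ c) → subgroupH1 (kerD κ 𝔭) (W.geomPrimaryTorsion p))}
    (hΨ : ∀ (f : Fin (p ^ c) → subgroupH1 (kerD κ 𝔭) (W.geomPrimaryTorsion p)) (i : Fin (p ^ c)), Ψ f i = φ (f i))
    (s : selmerAc W p κ v₀ S) :
    Θ ((conjSelmerAc W p κ v₀ S (γ ^ p ^ c) - 1) s) = (Ψ - 1) (Θ s) := by
  funext i
  rw [IwasawaDual.End_sub_apply, AddMonoid.End.one_apply, IwasawaDual.End_sub_apply, AddMonoid.End.one_apply, map_sub,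
    Pi.sub_apply, Pi.sub_apply, hΨ, hφ, hΘ, hΘ, coe_conjSelmerAc_apply, resKerD_conjH1_pow_index W p κ hγ d₁ hd₁]

/-! ### §3 The reduction: GV Prop. 2.1 at the strict place from the LOCAL two-sided count -/

/-- **Greenberg–Vatsal Prop. 2.1 at the strict place from a LOCAL two-sided count (growth road).** See the module docstring.
[cite: GreenbergVatsal2000, §2 Prop. (2.1) (pp. 23–24)] [cite: GreenbergLNM1716, §1 p. 60, §3 Lemma 3.1]
[cite: Washington1997, §13.2] -/
theorem exists_mem_selmerAc_forall_resKerD_eq_of_localCount [IsTotallyComplex K]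
    (hPT : ∀ n : ℕ, poitouTate_selmerStructure_duality (κ.layer n))
    (hB : FixedPoints.addSubgroup κ.kerSubgroup (W.geomPrimaryTorsion p) = ⊥)
    {γ : absoluteGaloisGroup K} (hγ : κ.IsTopGenerator γ) {𝔭 : HeightOneSpectrum (𝓞 K)}
    {S : Set (HeightOneSpectrum (𝓞 K))} (hS : S.Finite) {v₀ : HeightOneSpectrum (𝓞 K)}
    (hv₀ : ((p : ℕ) : 𝓞 K) ∉ v₀.asIdeal)
    (hfinS : Set.Finite {s : selmerAc W p κ 𝔭 S | p • s = 0})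
    {c : ℕ} {d₁ : decomp (K := K) 𝔭} (hd₁ : (κ (d₁ : absoluteGaloisGroup K)).toAdd = (p : ℤ_[p]) ^ c)
    (hc : ∀ z : ℤ_[p], ∃ d : decomp (K := K) 𝔭, (κ (d : absoluteGaloisGroup K)).toAdd = (p : ℤ_[p]) ^ c * z)
    {b : ℕ}
    (hfin : ∀ n k : ℕ, Set.Finite {y : subgroupH1 (kerD κ 𝔭) (W.geomPrimaryTorsion p) |
      p ^ k • y = 0 ∧ conjH1 (kerD κ 𝔭) (W.geomPrimaryTorsion p) (d₁ ^ p ^ n) y = y})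
    (hlow : ∀ n k : ℕ, p ^ (Module.finrank ℚ K * p ^ n * k) ≤
      p ^ b * Nat.card {y : subgroupH1 (kerD κ 𝔭) (W.geomPrimaryTorsion p) //
        p ^ k • y = 0 ∧ conjH1 (kerD κ 𝔭) (W.geomPrimaryTorsion p) (d₁ ^ p ^ n) y = y})
    (hup : ∀ n k : ℕ, Nat.card {y : subgroupH1 (kerD κ 𝔭) (W.geomPrimaryTorsion p) //
        p ^ k • y = 0 ∧ conjH1 (kerD κ 𝔭) (W.geomPrimaryTorsion p) (d₁ ^ p ^ n) y = y} ≤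
      p ^ (Module.finrank ℚ K * p ^ n * k + b))
    (F : absoluteGaloisGroup K → subgroupH1 (kerD κ 𝔭) (W.geomPrimaryTorsion p))
    (hFH : ∀ (σ h : absoluteGaloisGroup K), h ∈ κ.kerSubgroup → F (σ * h) = F σ)
    (hFD : ∀ (d : decomp (K := K) 𝔭) (σ : absoluteGaloisGroup K),
      F ((d : absoluteGaloisGroup K) * σ) = conjH1 (kerD κ 𝔭) (W.geomPrimaryTorsion p) d (F σ)) :
    ∃ s ∈ selmerAc W p κ v₀ S, ∀ σ : absoluteGaloisGroup K,
      resKerD κ (W.geomPrimaryTorsion p) 𝔭 (W.conjH1 p κ.kerSubgroup σ s) = F σ := by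
  -- (0) reduction to the tuple map `Θ` (kept opaque: only its defining property `hΘ` is used)
  refine exists_forall_resKerD_eq_of_forall_tuple W p κ hγ hc (selmerAc W p κ v₀ S) ?_ F hFH hFD
  obtain ⟨Θ, hΘ⟩ : ∃ Θ : selmerAc W p κ v₀ S →+ (Fin (p ^ c) → subgroupH1 (kerD κ 𝔭) (W.geomPrimaryTorsion p)),
      ∀ (s : selmerAc W p κ v₀ S) (i : Fin (p ^ c)),
        Θ s i = resKerD κ (W.geomPrimaryTorsion p) 𝔭 (W.conjH1 p κ.kerSubgroup (γ ^ (i : ℕ)) s) :=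
    ⟨{ toFun := fun s i ↦ resKerD κ (W.geomPrimaryTorsion p) 𝔭 (W.conjH1 p κ.kerSubgroup (γ ^ (i : ℕ)) s)
       map_zero' := by funext i; simp only [ZeroMemClass.coe_zero, map_zero, Pi.zero_apply]
       map_add' := fun s t ↦ by funext i; simp only [AddMemClass.coe_add, map_add, Pi.add_apply] },
      fun _ _ ↦ rfl⟩
  intro f
  suffices hsurj : Function.Surjective Θ by
    obtain ⟨s, hs⟩ := hsurj f
    exact ⟨s, s.2, fun i ↦ by rw [← hΘ, hs]⟩
  -- (1) the endomorphisms `φ = conj_{d₁}` on `𝓗` and `Ψ` componentwise (opaque), `Ψ − 1` locally nilpotent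
  obtain ⟨φ, hφ⟩ : ∃ φ : AddMonoid.End (subgroupH1 (kerD κ 𝔭) (W.geomPrimaryTorsion p)),
      ∀ y, φ y = conjH1 (kerD κ 𝔭) (W.geomPrimaryTorsion p) d₁ y :=
    ⟨conjH1 (kerD κ 𝔭) (W.geomPrimaryTorsion p) d₁, fun _ ↦ rfl⟩
  obtain ⟨Ψ, hΨ⟩ : ∃ Ψ : AddMonoid.End (Fin (p ^ c) → subgroupH1 (kerD κ 𝔭) (W.geomPrimaryTorsion p)),
      ∀ (f : Fin (p ^ c) → subgroupH1 (kerD κ 𝔭) (W.geomPrimaryTorsion p)) (i : Fin (p ^ c)), Ψ f i = φ (f i) :=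
    ⟨AddMonoidHom.compLeft (φ : subgroupH1 (kerD κ 𝔭) (W.geomPrimaryTorsion p) →+
      subgroupH1 (kerD κ 𝔭) (W.geomPrimaryTorsion p)) (Fin (p ^ c)), fun _ _ ↦ rfl⟩
  have hψP : ∀ (f : Fin (p ^ c) → subgroupH1 (kerD κ 𝔭) (W.geomPrimaryTorsion p)) (i : Fin (p ^ c)),
      (Ψ - 1) f i = (φ - 1) (f i) := fun f i ↦ by
    rw [IwasawaDual.End_sub_apply, AddMonoid.End.one_apply, IwasawaDual.End_sub_apply, AddMonoid.End.one_apply,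
      Pi.sub_apply, hΨ]
  have hLP : IsLocNil p (Ψ - 1) :=
    isLocNil_of_componentwise p (isLocNil_conjH1_kerD_geomPrimaryTorsion_sub_one W p κ hc d₁ hd₁ hφ) hψP
  have hLY := isLocNil_conjSelmerAc_pow_sub_one W p κ hγ v₀ S (p ^ c)
  -- (2) the `Λ_c`-structures on the duals; finite generation; torsion-freeness of `X_P` (p664548)
  letI instY := hLY.module (A := AddCircle (1 : ℚ))
  letI instP := hLP.module (A := AddCircle (1 : ℚ))
  haveI := moduleFinite_dual_selmerAc W p κ hγ v₀ hS c hLY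
  have hT1 := hfin 0 1
  rw [pow_zero, pow_one, pow_one] at hT1
  haveI := moduleFinite_dual_tuple W p κ d₁ (p ^ c) hφ hΨ hLP hT1
  haveI := noZeroSMulDivisors_dual_tuple W p κ d₁ hd₁ (p ^ c) hφ hΨ hLP hT1 hlow hup
  obtain ⟨e, f₀, hef⟩ := exists_natCard_pTorsion_pow_selmerAc_le W p κ hγ 𝔭 hS hfinS
  -- (3) the abstract growth road with the three counts
  refine surjective_of_dualPair_growth p hLY hLP Θ (tuple_conjSelmerAc_pow_sub_one W p κ hγ d₁ hd₁ Θ hΘ hφ hΨ)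
    (Module.finrank ℚ K * p ^ c) (b * p ^ c) e f₀ (fun m ↦ ?_) (fun m ↦ ?_) (fun m ↦ ?_)
  · -- hQ: the local count to the `p^c`
    rw [natCard_tuple_torsion_fixed_eq_pow p κ d₁ (p ^ c) m m hφ hΨ]
    have h1 := Nat.pow_le_pow_left (hup m m) (p ^ c)
    rw [← pow_mul] at h1
    have e2 : Module.finrank ℚ K * p ^ c * m * p ^ m + b * p ^ c = (Module.finrank ℚ K * p ^ m * m + b) * p ^ c := by
      ring
    rw [e2]
    exact h1
  · -- hX: `{s ∈ ker Θ | p^m s = 0} ↪ Sel_𝔭^Σ[p^m]`, `# ≤ p^{em+f}`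
    obtain ⟨ι, hι⟩ := exists_injective_kerTuple_pTorsion W p κ hγ hc Θ hΘ m
    exact ⟨_, (hef m).1, ι, hι, (hef m).2⟩
  · -- hY: weak-Leopoldt growth at layer `c + m` with constants `1`
    exact prime_pow_le_natCard_pTorsion_inf_conjSelmerAc_pow_fixed W p κ hPT hB hγ v₀ hv₀ hS c m

end Summit.BirchSwinnertonDyer.BirchSwinnertonDyer.Theorems.UniversalToricDescentStrictPlaceGrowth

end
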